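import Summits.KontsevichZagierPeriods.KontsevichZagierPeriods.Theorems.LiftingCriteriaDilationTransferConclusionOfCubeKernel
import Summits.KontsevichZagierPeriods.KontsevichZagierPeriods.Theorems.LiftingCriteriaDilationTransferHomogScale

/-!
# `DilationTransfer` for homogeneous relations on the square with exact symmetrisation (crux stmt-KontsevichZagierPeriods-3572, rung)

Support file for crux `DilationTransfer`
(`Summit.KontsevichZagierPeriods.KontsevichZagierPeriods.Theses.LiftingCriteria.DilationTransfer`,
route `LiftingCriteria`, line `birth`, reshape 4): the FIRST UNCONDITIONAL RUNG of the crux above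
pencil dimension one, and the first that uses a change of variables and domain additivity — moves
the line could not touch before reshape 4.

* `dilationTransfer_homog_dim_two_exactSym` — the conclusion of `DilationTransfer` for cube-Nash
  data of dimensions `nᵢ ≤ 2` whose functional relation is HOMOGENEOUS
  (`m₀ + Σ mᵢ v_{gᵢ}(ϖ) ≡ 0` on `[0,1]`, no witness) and whose symmetrisation is EXACT: reading the
  data on the square as `F(y) = m₀ + Σ mᵢ gᵢ(πᵢ y)`, there is a Nash function `R` near the lower
  triangle `P = {y ∈ [0,1]² | y₁ ≤ y₀}` with `∂R/∂y₁ = F + F∘σ` on `P`. This contains every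
  PERMUTATION / ANTISYMMETRIC datum (`F∘σ = −F`, `R = 0`) — the data on which the tame Stokes normal
  form of reshape 3 was untestable — and every rational datum whose Hermite reduction over `ℚ(s)`
  has no logarithmic part.

Proof (`Theorems/…HomogScale.lean` supplies the moves at every rational scale `σ ∈ (0,1]`):
`[[0,1]², F(σ·)] ≡ [[0,1], s ↦ (R(σs,σs) − R(σs,0))/σ]` (pyramid + Newton–Leibniz on the triangle),
relations preserve values, and the homogeneous relation kills `∫_{[0,1]²} F(σy)dy` at every scale;
hence `∫₀^σ ρ = 0` for `ρ(s) = R(s,s) − R(s,0)` and all rational `σ`, so `ρ ≡ 0` on `[0,1]` (density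
of `ℚ`, continuity, fundamental theorem of calculus). At the scale `ϖ₀` the boundary representation
therefore has integrand `0`, is a relation, and so is `[[0,1]², F(ϖ₀·)]`; `conclusion_of_cubeKernel`
recombines.

## References
* M. Kontsevich, D. Zagier, *Periods* (2001), §1.2 (rules (1)–(3)).
-/

noncomputable section

open scoped BigOperators Topology
open MeasureTheory Set Filter
open Literature.NumberTheory.Transcendental
open Literature.ModelTheory.ExponentialFields (IsSemialgebraic)

namespace Summit.KontsevichZagierPeriods.LiftingCriteria.DilationTransfer

/-- **A continuous function on `[0,1]` all of whose integrals `∫₀^σ` over rational `σ ∈ (0,1)`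
vanish is identically zero on `[0,1]`** (density of `ℚ`, continuity of the primitive, fundamental
theorem of calculus, closure of `(0,1)`). [folklore] -/
theorem eqOn_zero_of_forall_rat_integral_eq_zero {ρ : ℝ → ℝ}
    (hρ : ∀ s ∈ Set.Icc (0:ℝ) 1, ContinuousAt ρ s)
    (h : ∀ σ : ℚ, 0 < σ → σ < 1 → ∫ v in (0:ℝ)..σ, ρ v = 0) :
    Set.EqOn ρ 0 (Set.Icc (0:ℝ) 1) := by
  have hρc : ContinuousOn ρ (Set.Icc 0 1) := fun s hs => (hρ s hs).continuousWithinAt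
  -- the primitive `Φ(x) = ∫₀ˣ ρ` is continuous on `[0,1]` and vanishes at the rationals of `(0,1)`
  set Φ : ℝ → ℝ := fun x => ∫ v in (0:ℝ)..x, ρ v with hΦ
  have hΦc : ContinuousOn Φ (Set.Icc 0 1) := by
    have hint : IntegrableOn ρ (Set.uIcc 0 1) volume := by
      rw [Set.uIcc_of_le zero_le_one]
      exact hρc.integrableOn_compact isCompact_Icc
    have h1 := intervalIntegral.continuousOn_primitive_interval (μ := volume) hint
    rwa [Set.uIcc_of_le zero_le_one] at h1
  have hD : Set.Icc (0:ℝ) 1 ⊆ closure (Set.Ioo (0:ℝ) 1 ∩ Set.range ((↑) : ℚ → ℝ)) := by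
    have h1 : Set.Ioo (0:ℝ) 1 ⊆ closure (Set.Ioo (0:ℝ) 1 ∩ Set.range ((↑) : ℚ → ℝ)) :=
      Rat.denseRange_cast.open_subset_closure_inter isOpen_Ioo
    have h2 : closure (Set.Ioo (0:ℝ) 1) ⊆ closure (Set.Ioo (0:ℝ) 1 ∩ Set.range ((↑) : ℚ → ℝ)) := by
      simpa only [closure_closure] using closure_mono h1
    rwa [closure_Ioo zero_ne_one] at h2
  have hΦ0 : Set.EqOn Φ 0 (Set.Icc 0 1) := by
    refine Set.EqOn.of_subset_closure ?_ hΦc continuousOn_const (fun x hx => ⟨hx.1.1.le, hx.1.2.le⟩) hD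
    rintro x ⟨hx, ⟨σ, rfl⟩⟩
    exact h σ (by exact_mod_cast hx.1) (by exact_mod_cast hx.2)
  -- hence `ρ = Φ' = 0` on `(0,1)`
  have hIoo : Set.EqOn ρ 0 (Set.Ioo 0 1) := by
    intro x hx
    have hxI : Set.Ioo (0:ℝ) 1 ∈ 𝓝 x := isOpen_Ioo.mem_nhds hx
    have hder : HasDerivAt Φ (ρ x) x := by
      have hint : IntervalIntegrable ρ volume 0 x :=
        (hρc.mono (Set.Icc_subset_Icc le_rfl hx.2.le)).intervalIntegrable_of_Icc hx.1.le
      have hmeas : StronglyMeasurableAtFilter ρ (𝓝 x) :=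
        ContinuousOn.stronglyMeasurableAtFilter isOpen_Ioo
          (fun s hs => (hρ s ⟨hs.1.le, hs.2.le⟩).continuousWithinAt) x hx
      exact intervalIntegral.integral_hasDerivAt_right hint hmeas (hρ x ⟨hx.1.le, hx.2.le⟩)
    have hzero : HasDerivAt Φ 0 x := by
      refine (hasDerivAt_const x (0:ℝ)).congr_of_eventuallyEq ?_
      filter_upwards [hxI] with y hy
      exact hΦ0 ⟨hy.1.le, hy.2.le⟩
    exact hder.unique hzero
  -- and on `[0,1]` by continuity
  have hcl : Set.Icc (0:ℝ) 1 ⊆ closure (Set.Ioo (0:ℝ) 1) := by rw [closure_Ioo zero_ne_one]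
  exact Set.EqOn.of_subset_closure hIoo hρc continuousOn_const Set.Ioo_subset_Icc_self hcl

/-- **Assembly of the homogeneous layer on the square from scale packages.** If at every rational scale
`σ ∈ (0,1]` the moves of the calculus provide representations `A_σ = [[0,1]², F(σ·)]` and
`Z_σ = [[0,1], s ↦ (R(σs,σs) − R(σs,0))/σ]` with `[A_σ] − [Z_σ] ∈ KZ.relations` and the two values
computed (a SCALE PACKAGE, as produced by `homog_scale_moves_rem`), then the HOMOGENEOUS relation
`m₀ + Σ mᵢ ∫ gᵢ(ϖz)dz ≡ 0` gives `∫₀^σ ρ = 0`, `ρ(s) = R(s,s) − R(s,0)`, for all rational `σ`, hence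
`ρ ≡ 0` on `[0,1]` (`eqOn_zero_of_forall_rat_integral_eq_zero`), so at the scale `ϖ₀` the boundary
representation — and with it every cube representation of `F(ϖ₀·)` — is a relation.
[cite: KontsevichZagier2001, §1.2 Conjecture 1] -/
theorem cubeKernel_of_scalePackages {S : ℕ} {n : Fin S → ℕ} {g : (i : Fin S) → (Fin (n i) → ℝ) → ℝ}
    (hn2 : ∀ i, n i ≤ 2) (m : Fin S → ℤ) (m₀ : ℤ) {ϖ₀ : ℚ} (hϖ0 : 0 < ϖ₀) (hϖ1 : ϖ₀ ≤ 1)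
    (hhom : ∀ ϖ ∈ Set.Icc (0:ℝ) 1, (m₀ : ℝ) + ∑ i, (m i : ℝ) *
      (∫ z in Set.pi Set.univ (fun _ : Fin (n i) => Set.Icc (0:ℝ) 1), g i (ϖ • z)) = 0)
    {W : Set (Fin 2 → ℝ)} {R : (Fin 2 → ℝ) → ℝ}
    (hPW : {y : Fin 2 → ℝ | y ∈ KZ.cube 2 ∧ y 1 ≤ y 0} ⊆ W) (hRa : AnalyticOnNhd ℝ R W)
    (hpack : ∀ σ : ℚ, 0 < σ → σ ≤ 1 → ∃ (A : KZ.IntegralRep 2) (Z : KZ.IntegralRep 1),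
      A.domain = KZ.cube 2 ∧
      (∀ v, A.integrand v = (m₀ : ℝ) + ∑ i, (m i : ℝ) * g i ((σ : ℝ) • (fun l : Fin (n i) => v (Fin.castLE (hn2 i) l)))) ∧
      Z.domain = KZ.cube 1 ∧
      (∀ x, Z.integrand x = (R ((σ : ℝ) • (![x 0, x 0] : Fin 2 → ℝ)) - R ((σ : ℝ) • (![x 0, 0] : Fin 2 → ℝ))) / σ) ∧
      KZ.of A - KZ.of Z ∈ KZ.relations ∧
      A.value = (m₀ : ℝ) + ∑ i, (m i : ℝ) * (∫ z in Set.pi Set.univ (fun _ : Fin (n i) => Set.Icc (0:ℝ) 1), g i ((σ : ℝ) • z)) ∧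
      Z.value = ∫ s in Set.Icc (0:ℝ) 1, (R ((σ : ℝ) • (![s, s] : Fin 2 → ℝ)) - R ((σ : ℝ) • (![s, 0] : Fin 2 → ℝ))) / σ) :
    ∀ A : KZ.IntegralRep 2, A.domain = KZ.cube 2 →
      (∀ v ∈ KZ.cube 2, A.integrand v = (m₀ : ℝ) + ∑ i, (m i : ℝ) *
        g i ((ϖ₀ : ℝ) • (fun l : Fin (n i) => v (Fin.castLE (hn2 i) l)))) →
      KZ.of A ∈ KZ.relations := by
  intro A hAd hAi
  -- the boundary function `ρ(s) = R(s,s) − R(s,0)` and its continuity on `[0,1]`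
  set ρ : ℝ → ℝ := fun s => R (![s, s] : Fin 2 → ℝ) - R (![s, 0] : Fin 2 → ℝ) with hρ
  have hρc : ∀ s ∈ Set.Icc (0:ℝ) 1, ContinuousAt ρ s := by
    intro s hs
    have hd : ContinuousAt (fun s : ℝ => (![s, s] : Fin 2 → ℝ)) s :=
      continuousAt_pi.2 fun i => by fin_cases i <;> exact continuousAt_id
    have hb : ContinuousAt (fun s : ℝ => (![s, 0] : Fin 2 → ℝ)) s :=
      continuousAt_pi.2 fun i => by fin_cases i <;> [exact continuousAt_id; exact continuousAt_const]
    have hmd : (![s, s] : Fin 2 → ℝ) ∈ W := by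
      refine hPW ⟨fun i => ?_, by simp⟩
      fin_cases i <;> simp [hs.1, hs.2]
    have hmb : (![s, 0] : Fin 2 → ℝ) ∈ W := by
      refine hPW ⟨fun i => ?_, by simp [hs.1]⟩
      fin_cases i <;> simp [hs.1, hs.2]
    exact ((hRa _ hmd).continuousAt.comp_of_eq hd rfl).sub ((hRa _ hmb).continuousAt.comp_of_eq hb rfl)
  -- (1) at every rational scale `σ ∈ (0,1)`: `∫₀^σ ρ = 0`
  have hscale : ∀ σ : ℚ, 0 < σ → σ < 1 → ∫ v in (0:ℝ)..σ, ρ v = 0 := by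
    intro σ hσ0 hσ1
    have hσ0' : (0:ℝ) < (σ:ℝ) := by exact_mod_cast hσ0
    have hσne : (σ:ℝ) ≠ 0 := hσ0'.ne'
    obtain ⟨Aσ, Zσ, -, -, -, -, hrel, hvA, hvZ⟩ := hpack σ hσ0 hσ1.le
    have hv : Aσ.value = Zσ.value := KZ.Equivalent.value_eq_holds hrel
    have hA0 : Aσ.value = 0 := by
      rw [hvA]
      exact hhom (σ : ℝ) ⟨hσ0'.le, by exact_mod_cast hσ1.le⟩
    have hZ0 : (∫ s in Set.Icc (0:ℝ) 1, ρ ((σ : ℝ) * s) / σ) = 0 := by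
      have h := hvZ
      simp only [smul_vec_two, mul_zero] at h
      have h' : (∫ s in Set.Icc (0:ℝ) 1,
          (R (![(σ : ℝ) * s, (σ : ℝ) * s] : Fin 2 → ℝ) - R (![(σ : ℝ) * s, 0] : Fin 2 → ℝ)) / σ) = 0 := by
        rw [← h, ← hv, hA0]
      simpa only [hρ] using h'
    have h1 : (∫ s in Set.Icc (0:ℝ) 1, ρ ((σ : ℝ) * s) / σ) = (σ : ℝ)⁻¹ * ((σ : ℝ)⁻¹ * ∫ v in (0:ℝ)..σ, ρ v) := by
      rw [integral_Icc_eq_integral_Ioc, ← intervalIntegral.integral_of_le zero_le_one,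
        intervalIntegral.integral_div, intervalIntegral.integral_comp_mul_left ρ hσne,
        mul_zero, mul_one, smul_eq_mul, div_eq_inv_mul]
    rw [h1] at hZ0
    have hinv : (σ : ℝ)⁻¹ ≠ 0 := inv_ne_zero hσne
    rcases mul_eq_zero.1 hZ0 with h | h
    · exact absurd h hinv
    · rcases mul_eq_zero.1 h with h' | h'
      · exact absurd h' hinv
      · exact h'
  -- (2) hence `ρ ≡ 0` on `[0,1]`
  have hρ0 : Set.EqOn ρ 0 (Set.Icc (0:ℝ) 1) := eqOn_zero_of_forall_rat_integral_eq_zero hρc hscale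
  -- (3) at the scale `ϖ₀` the boundary representation is a relation, hence so is `[[0,1]², F(ϖ₀·)]`
  have hϖ0' : (0:ℝ) ≤ (ϖ₀:ℝ) := by exact_mod_cast hϖ0.le
  have hϖ1' : (ϖ₀:ℝ) ≤ 1 := by exact_mod_cast hϖ1
  obtain ⟨A₀, Z₀, hA₀d, hA₀i, hZ₀d, hZ₀i, hrel₀, -, -⟩ := hpack ϖ₀ hϖ0 hϖ1
  have hZ₀ : KZ.of Z₀ ∈ KZ.relations := by
    refine KZ.of_mem_relations_of_eqOn_zero Z₀ fun x hx => ?_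
    rw [hZ₀d] at hx
    have hx0 := KZ.mem_cube.1 hx 0
    have hmem : (ϖ₀ : ℝ) * x 0 ∈ Set.Icc (0:ℝ) 1 :=
      ⟨mul_nonneg hϖ0' hx0.1, mul_le_one₀ hϖ1' hx0.1 hx0.2⟩
    have h := hρ0 hmem
    simp only [hρ, Pi.zero_apply] at h
    rw [hZ₀i x]
    simp only [smul_vec_two, mul_zero, Pi.zero_apply, h, zero_div]
  have hA₀ : KZ.of A₀ ∈ KZ.relations := by
    have e : KZ.of A₀ = (KZ.of A₀ - KZ.of Z₀) + KZ.of Z₀ := by abel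
    rw [e]
    exact KZ.relations.add_mem hrel₀ hZ₀
  have hAA₀ : KZ.of A - KZ.of A₀ ∈ KZ.relations := by
    refine KZ.of_sub_of_mem_relations_of_eqOn (by rw [hAd, hA₀d]) fun v hv => ?_
    rw [hAd] at hv
    rw [hAi v hv, hA₀i v]
  have e : KZ.of A = (KZ.of A - KZ.of A₀) + KZ.of A₀ := by abel
  rw [e]
  exact KZ.relations.add_mem hAA₀ hA₀


/-- **`DilationTransfer` for homogeneous relations on the square with exact symmetrisation.** For
cube-Nash `gᵢ` of dimensions `nᵢ ≤ 2`, integers `mᵢ, m₀`, a rational `ϖ₀ ∈ (0,1]`, a HOMOGENEOUS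
functional relation `m₀ + Σ mᵢ ∫_{[0,1]^{nᵢ}} gᵢ(ϖz)dz = 0` for all `ϖ ∈ [0,1]`, and a Nash function
`R` near the lower triangle `P = {y ∈ [0,1]² | y₁ ≤ y₀}` with `∂R/∂y₁ = F + F∘σ` on `P`
(`F(y) = m₀ + Σ mᵢ gᵢ(πᵢ y)` the data read on the square, `σ` the swap): the conclusion of the crux
holds, `m₀·[u] + Σ mᵢ·[rᵢ] ∈ KZ.relations`. Covers all permutation/antisymmetric data (`R = 0`).
Proof: moves at every rational scale (`homog_scale_moves`), soundness of the calculus and the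
homogeneous relation give `∫₀^σ (R(s,s) − R(s,0))ds = 0` for all rational `σ`, hence
`R(s,s) ≡ R(s,0)` (`eqOn_zero_of_forall_rat_integral_eq_zero`); at the scale `ϖ₀` the boundary
representation is then a relation, and `conclusion_of_cubeKernel` recombines.
[cite: KontsevichZagier2001, §1.2 Conjecture 1 and rules (1)–(3)] -/
theorem dilationTransfer_homog_dim_two_exactSym :
    ∀ (S : ℕ) (n : Fin S → ℕ) (g : (i : Fin S) → (Fin (n i) → ℝ) → ℝ) (U : (i : Fin S) → Set (Fin (n i) → ℝ)), (∀ i, IsOpen (U i) ∧ Set.pi Set.univ (fun _ : Fin (n i) => Set.Icc (0:ℝ) 1) ⊆ (U i) ∧ Literature.NumberTheory.Transcendental.IsSemialgebraicFunOn ℚ (U i) (g i) ∧ AnalyticOnNhd ℝ (g i) (U i)) → ∀ (hn2 : ∀ i, n i ≤ 2) (m : Fin S → ℤ) (m₀ : ℤ) (ϖ₀ : ℚ), 0 < ϖ₀ → ϖ₀ ≤ 1 → (∀ ϖ ∈ Set.Icc (0:ℝ) 1, (m₀ : ℝ) + ∑ i, (m i : ℝ) * (∫ z in Set.pi Set.univ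 (fun _ : Fin (n i) => Set.Icc (0:ℝ) 1), g i (ϖ • z)) = 0) → (∃ (W : Set (Fin 2 → ℝ)) (R : (Fin 2 → ℝ) → ℝ), IsOpen W ∧ {y : Fin 2 → ℝ | y ∈ Literature.NumberTheory.Transcendental.KZ.cube 2 ∧ y 1 ≤ y 0} ⊆ W ∧ Literature.NumberTheory.Transcendental.IsSemialgebraicFunOn ℚ W R ∧ AnalyticOnNhd ℝ R W ∧ ∀ y ∈ {y : Fin 2 → ℝ | y ∈ Literature.NumberTheory.Transcendental.KZ.cube 2 ∧ y 1 ≤ y 0}, fderiv ℝ R y (Pi.single 1 1) = ((m₀ : ℝ) + ∑ i, (m i : ℝ) * g i (fun l : Fin (n i) => y (Fin.castLE (hn2 i) l))) + ((m₀ : ℝ) + ∑ i, (m i : ℝ) * g i (fun l : Fin (n i) => y (Equiv.swap (0 : Fin 2) 1 (Fin.castLE (hn2 i) l))))) → ∀ (r : (i : Fin S) → Literature.NumberTheory.Transcendental.KZ.IntegralRep (n i)) (u : Literature.NumberTheory.Transcendental.KZ.IntegralRep 0), (∀ i, (r i).domain = Set.pi Set.univ (fun _ : Fin (n i) => Set.Icc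 (0:ℝ) 1) ∧ ∀ z ∈ Set.pi Set.univ (fun _ : Fin (n i) => Set.Icc (0:ℝ) 1), (r i).integrand z = g i ((ϖ₀ : ℝ) • z)) → u.domain = Set.univ → (∀ x, u.integrand x = 1) → m₀ • Literature.NumberTheory.Transcendental.KZ.of u + ∑ i, m i • Literature.NumberTheory.Transcendental.KZ.of (r i) ∈ Literature.NumberTheory.Transcendental.KZ.relations := by
  intro S n g U hg hn2 m m₀ ϖ₀ hϖ0 hϖ1 hhom hE r u hr hu1 hu2
  obtain ⟨W, R, _hWo, hPW, hRs, hRa, hRder⟩ := hE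
  exact conclusion_of_cubeKernel S n g U hg m m₀ ϖ₀ hϖ0 hϖ1 2 hn2
    (cubeKernel_of_scalePackages hn2 m m₀ hϖ0 hϖ1 hhom hPW hRa fun σ hσ0 hσ1 =>
      homog_scale_moves hg hn2 m m₀ hPW hRs hRa hRder σ hσ0 hσ1) r u hr hu1 hu2

end Summit.KontsevichZagierPeriods.LiftingCriteria.DilationTransfer
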